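import Literature.Geometry.Riemannian.ChangGurskyYangRegularity
import HarnessLib

/-!
# `|W|² = |Rm|² − (4/(m−2))|Ric|² + (2/((m−1)(m−2))) S²` in every dimension `m ≥ 3`, and the
# continuity of the Weyl norm `|W_g|²`

Topic `Geometry/Riemannian`; everything is PROVED (no definition, no named fact). Support file for
the named fact `Literature.Geometry.Riemannian.liQingShi_pinching_five` (Li–Qing–Shi 2017,
Thm. 1.8 at bulk dimension `n = 5`, `LiQingShiPinching.lean`): Step 1 of its printed proof
(arXiv:1410.6402, pp. 12–13) maximises the Weyl norm `|W|[g⁺]` over a `5`-dimensional bulk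
("there exists a point `p_j` so that `τ_j = |W|[g⁺_j](p_j) = max |W|[g⁺_j]`"), which uses that
`p ↦ |W|²(p)` is a CONTINUOUS function. The tree had the continuity of `|W|²`
(`PseudoRiemannianMetric.continuous_weylNormSq`, `ChangGurskyYangRegularity.lean`) only on a
`4`-dimensional model, through the dimension-four identity `|W|² = |Rm|² − 2|Ric|² + S²/3`
(`weylNormSqFrame_eq_curvNormSqFrame`, proved by expanding the `4⁴` frame components). Here the
identity and the continuity are proved in every dimension `m = dim E ≥ 3`, by frame algebra over an
arbitrary finite index type:

* bookkeeping over a finite index type `ι`, `m = |ι|`: the pairings of a frame `4`-array `T` with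
  `h ⊙ δ` (`sum_mul_kulkarniNomizu_frameDelta_card`: four contractions of `T` against `h`) and with
  `D = δ_{il}δ_{jk} − δ_{ik}δ_{jl}` (`sum_mul_frameDeltaPair_card`: `Σ T_{ijji} − Σ T_{ijij}`); the
  four contractions of `h ⊙ δ` (`Σ_a (h⊙δ)_{abca}`, `Σ_b (h⊙δ)_{abbd}`, `Σ_b (h⊙δ)_{abcb}`,
  `Σ_a (h⊙δ)_{abad}`); hence `|h ⊙ δ|² = 4(m−2)|h|² + 4(tr h)²` (`sum_kulkarniNomizu_frameDelta_sq_card`,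
  the general case of `sum_kulkarniNomizu_frameDelta_sq` of `ChangGurskyYangProofs.lean`),
  `⟨h ⊙ δ, D⟩ = (4m−4) tr h`, `|D|² = 2m(m−1)`;
* contractions of the curvature array of the Levi-Civita connection of a `C²` metric in a frame
  computing `Ric` and `S` (antisymmetries `Rm_{ijkl} = −Rm_{jikl} = −Rm_{ijlk}`):
  `Σ_j Rm_{ijjl} = Ric_{il}`, `Σ_j Rm_{ijkj} = −Ric_{ik}`, `Σ_i Rm_{ijil} = −Ric_{jl}`,
  `Σ_{ij} Rm_{ijji} = S`, `Σ_{ij} Rm_{ijij} = −S`; hence `⟨Rm, Ric ⊙ δ⟩ = 4|Ric|²`, `⟨Rm, D⟩ = 2S`;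
* **`weylNormSqFrame_eq_curvNormSqFrame_card`** — `|W|² = |Rm|² − (4/(m−2))|Ric|² +
  (2/((m−1)(m−2))) S²` (Besse 1987, 1.116–1.117) in every frame of cardinality `m ≥ 3` computing
  the Ricci contraction and the scalar curvature — every orthonormal basis
  (`weylNormSqFrame_eq_curvNormSqFrame_of_isOrthonormalFrame_card`);
* **`weylNormSq_eq_curvNormSqWith_card`** — `|W_g|²(x) = |Rm|²_g − (4/(m−2))|Ric|²_g +
  (2/((m−1)(m−2))) S²` through the intrinsic quantities `curvNormSqWith`, `normSq Ric`,
  `scalarCurvature`, for a Riemannian `C^∞` metric on a model of dimension `m ≥ 3`;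
* **`continuous_weylNormSq_card`** — `|W_g|²` is continuous in every dimension `≥ 3`
  (`continuous_curvNormSqWith`, `contMDiff_normSq_ricci'`, `contMDiff_scalarCurvature`), and
  `continuous_weylNormSq_five` — the case of a `5`-manifold modelled on `ℝ⁵`, the bulk of
  `liQingShi_pinching_five`.

## References

* A. L. Besse, *Einstein Manifolds*, Springer 1987, 1.110, Thm. 1.114, (1.116)–1.117.
  [Besse1987]
* G. Li, J. Qing, Y. Shi, Trans. Amer. Math. Soc. 369 (2017) 4385–4413 (arXiv:1410.6402), proof
  of Thm. 1.8, Step 1 (pp. 12–13). [LiQingShi2017]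
* B. O'Neill, *Semi-Riemannian geometry* (1983), Ch. 3, Prop. 3.36, Lemma 3.52, Def. 3.53.
  [ONeill1983]
-/

noncomputable section

open Bundle Finset Module Set Filter
open scoped Manifold ContDiff Topology

namespace Literature.Geometry.Riemannian

/-! ### Frame algebra over a finite index type -/

section FrameAlgebra

variable {ι : Type*} [Fintype ι] [DecidableEq ι]

/-- `Σ_l f l δ_{al} = f a`. [folklore] -/
theorem sum_mul_frameDelta_left (f : ι → ℝ) (a : ι) : ∑ l, f l * frameDelta a l = f a := by
  simp only [frameDelta, mul_ite, mul_one, mul_zero, Finset.sum_ite_eq, Finset.mem_univ, if_true]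

/-- `Σ_l f l δ_{la} = f a`. [folklore] -/
theorem sum_mul_frameDelta_right (f : ι → ℝ) (a : ι) : ∑ l, f l * frameDelta l a = f a := by
  simp only [frameDelta, mul_ite, mul_one, mul_zero, Finset.sum_ite_eq', Finset.mem_univ, if_true]

/-- **Pairing of a frame `4`-array with `h ⊙ δ`**: `Σ_{ijkl} T_{ijkl} (h ⊙ δ)_{ijkl}` regroups into
the four contractions `Σ_j T_{ijjl}`, `Σ_i T_{ijki}`, `Σ_j T_{ijkj}`, `Σ_i T_{ijil}` paired with `h`
(any finite index type; the `Fin 4` case is `sum_mul_kulkarniNomizu_frameDelta` of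
`ChangGurskyYangProofs.lean`). [folklore] -/
theorem sum_mul_kulkarniNomizu_frameDelta_card (T : ι → ι → ι → ι → ℝ) (h : ι → ι → ℝ) :
    ∑ i, ∑ j, ∑ k, ∑ l, T i j k l * kulkarniNomizu h frameDelta i j k l =
      ∑ i, ∑ l, (∑ j, T i j j l) * h i l + ∑ j, ∑ k, (∑ i, T i j k i) * h j k -
        ∑ i, ∑ k, (∑ j, T i j k j) * h i k - ∑ j, ∑ l, (∑ i, T i j i l) * h j l := by
  -- term 1: `T_{ijkl} h_{il} δ_{jk}`
  have h1 : ∑ i, ∑ j, ∑ k, ∑ l, T i j k l * (h i l * frameDelta j k) =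
      ∑ i, ∑ l, (∑ j, T i j j l) * h i l := by
    have inner : ∀ i j, ∑ k, ∑ l, T i j k l * (h i l * frameDelta j k) = ∑ l, T i j j l * h i l := by
      intro i j
      rw [Finset.sum_comm]
      refine Finset.sum_congr rfl fun l _ ↦ ?_
      have : ∀ k, T i j k l * (h i l * frameDelta j k) = (T i j k l * h i l) * frameDelta j k :=
        fun k ↦ by ring
      simp_rw [this]
      exact sum_mul_frameDelta_left (fun k ↦ T i j k l * h i l) j
    simp_rw [inner]
    refine Finset.sum_congr rfl fun i _ ↦ ?_
    rw [Finset.sum_comm]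
    simp_rw [Finset.sum_mul]
  -- term 2: `T_{ijkl} h_{jk} δ_{il}`
  have h2 : ∑ i, ∑ j, ∑ k, ∑ l, T i j k l * (h j k * frameDelta i l) =
      ∑ j, ∑ k, (∑ i, T i j k i) * h j k := by
    have inner : ∀ i j k, ∑ l, T i j k l * (h j k * frameDelta i l) = T i j k i * h j k := by
      intro i j k
      have : ∀ l, T i j k l * (h j k * frameDelta i l) = (T i j k l * h j k) * frameDelta i l :=
        fun l ↦ by ring
      simp_rw [this]
      exact sum_mul_frameDelta_left (fun l ↦ T i j k l * h j k) i
    simp_rw [inner]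
    rw [Finset.sum_comm]
    refine Finset.sum_congr rfl fun j _ ↦ ?_
    rw [Finset.sum_comm]
    simp_rw [Finset.sum_mul]
  -- term 3: `T_{ijkl} h_{ik} δ_{jl}`
  have h3 : ∑ i, ∑ j, ∑ k, ∑ l, T i j k l * (h i k * frameDelta j l) =
      ∑ i, ∑ k, (∑ j, T i j k j) * h i k := by
    have inner : ∀ i j k, ∑ l, T i j k l * (h i k * frameDelta j l) = T i j k j * h i k := by
      intro i j k
      have : ∀ l, T i j k l * (h i k * frameDelta j l) = (T i j k l * h i k) * frameDelta j l :=
        fun l ↦ by ring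
      simp_rw [this]
      exact sum_mul_frameDelta_left (fun l ↦ T i j k l * h i k) j
    simp_rw [inner]
    refine Finset.sum_congr rfl fun i _ ↦ ?_
    rw [Finset.sum_comm]
    simp_rw [Finset.sum_mul]
  -- term 4: `T_{ijkl} h_{jl} δ_{ik}`
  have h4 : ∑ i, ∑ j, ∑ k, ∑ l, T i j k l * (h j l * frameDelta i k) =
      ∑ j, ∑ l, (∑ i, T i j i l) * h j l := by
    have inner : ∀ i j, ∑ k, ∑ l, T i j k l * (h j l * frameDelta i k) = ∑ l, T i j i l * h j l := by
      intro i j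
      rw [Finset.sum_comm]
      refine Finset.sum_congr rfl fun l _ ↦ ?_
      have : ∀ k, T i j k l * (h j l * frameDelta i k) = (T i j k l * h j l) * frameDelta i k :=
        fun k ↦ by ring
      simp_rw [this]
      exact sum_mul_frameDelta_left (fun k ↦ T i j k l * h j l) i
    simp_rw [inner]
    rw [Finset.sum_comm]
    refine Finset.sum_congr rfl fun j _ ↦ ?_
    rw [Finset.sum_comm]
    simp_rw [Finset.sum_mul]
  have hsplit : ∀ i j k l, T i j k l * kulkarniNomizu h frameDelta i j k l =
      T i j k l * (h i l * frameDelta j k) + T i j k l * (h j k * frameDelta i l) -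
        T i j k l * (h i k * frameDelta j l) - T i j k l * (h j l * frameDelta i k) := by
    intro i j k l
    simp only [kulkarniNomizu]
    ring
  simp only [hsplit, Finset.sum_add_distrib, Finset.sum_sub_distrib, h1, h2, h3, h4]

/-- **Pairing of a frame `4`-array with `D = δ_{il}δ_{jk} − δ_{ik}δ_{jl}`** (the scalar-curvature
pattern of `weylFrame_apply`): `Σ_{ijkl} T_{ijkl} D_{ijkl} = Σ_{ij} T_{ijji} − Σ_{ij} T_{ijij}`.
[folklore] -/
theorem sum_mul_frameDeltaPair_card (T : ι → ι → ι → ι → ℝ) :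
    ∑ i, ∑ j, ∑ k, ∑ l, T i j k l *
        ((if i = l then 1 else 0) * (if j = k then 1 else 0) -
          (if i = k then 1 else 0) * (if j = l then 1 else 0)) =
      ∑ i, ∑ j, T i j j i - ∑ i, ∑ j, T i j i j := by
  have h1 : ∀ i j, ∑ k, ∑ l, T i j k l * ((if i = l then 1 else 0) * (if j = k then 1 else 0)) =
      T i j j i := by
    intro i j
    simp only [mul_ite, mul_one, mul_zero, Finset.sum_ite_eq, Finset.sum_ite_irrel,
      Finset.sum_const_zero, Finset.mem_univ, if_true]
  have h2 : ∀ i j, ∑ k, ∑ l, T i j k l * ((if i = k then 1 else 0) * (if j = l then 1 else 0)) =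
      T i j i j := by
    intro i j
    simp only [mul_ite, mul_one, mul_zero, Finset.sum_ite_eq, Finset.mem_univ, if_true]
  simp only [mul_sub, Finset.sum_sub_distrib, h1, h2]

/-- `Σ_b (h ⊙ δ)_{abbd} = (m−2) h_{ad} + (tr h) δ_{ad}` (`m = |ι|`). [cite: Besse1987, 1.116] -/
theorem sum_kulkarniNomizu_frameDelta_contract₂₃ (h : ι → ι → ℝ) (a d : ι) :
    ∑ b, kulkarniNomizu h frameDelta a b b d =
      ((Fintype.card ι : ℝ) - 2) * h a d + (∑ b, h b b) * frameDelta a d := by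
  have h1 : ∀ b, kulkarniNomizu h frameDelta a b b d =
      h a d + h b b * frameDelta a d - (if b = d then h a b else 0) - (if a = b then h b d else 0) := by
    intro b
    simp only [kulkarniNomizu, frameDelta, mul_ite, mul_one, mul_zero, if_true]
  simp only [h1, Finset.sum_sub_distrib, Finset.sum_add_distrib, Finset.sum_ite_eq,
    Finset.sum_ite_eq', Finset.mem_univ, if_true, Finset.sum_const, Finset.card_univ,
    nsmul_eq_mul, ← Finset.sum_mul]
  ring

/-- `Σ_a (h ⊙ δ)_{abca} = (m−2) h_{bc} + (tr h) δ_{bc}` (`m = |ι|`). [cite: Besse1987, 1.116] -/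
theorem sum_kulkarniNomizu_frameDelta_contract₁₄ (h : ι → ι → ℝ) (b c : ι) :
    ∑ a, kulkarniNomizu h frameDelta a b c a =
      ((Fintype.card ι : ℝ) - 2) * h b c + (∑ a, h a a) * frameDelta b c := by
  have h1 : ∀ a, kulkarniNomizu h frameDelta a b c a =
      h a a * frameDelta b c + h b c - (if b = a then h a c else 0) - (if a = c then h b a else 0) := by
    intro a
    simp only [kulkarniNomizu, frameDelta, mul_ite, mul_one, mul_zero, if_true]
  simp only [h1, Finset.sum_sub_distrib, Finset.sum_add_distrib, Finset.sum_ite_eq,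
    Finset.sum_ite_eq', Finset.mem_univ, if_true, Finset.sum_const, Finset.card_univ,
    nsmul_eq_mul, ← Finset.sum_mul]
  ring

/-- `Σ_b (h ⊙ δ)_{abcb} = −((m−2) h_{ac} + (tr h) δ_{ac})` (`m = |ι|`). [cite: Besse1987, 1.116] -/
theorem sum_kulkarniNomizu_frameDelta_contract₂₄ (h : ι → ι → ℝ) (a c : ι) :
    ∑ b, kulkarniNomizu h frameDelta a b c b =
      -(((Fintype.card ι : ℝ) - 2) * h a c + (∑ b, h b b) * frameDelta a c) := by
  have h1 : ∀ b, kulkarniNomizu h frameDelta a b c b =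
      (if b = c then h a b else 0) + (if a = b then h b c else 0) - h a c - h b b * frameDelta a c := by
    intro b
    simp only [kulkarniNomizu, frameDelta, mul_ite, mul_one, mul_zero, if_true]
  simp only [h1, Finset.sum_sub_distrib, Finset.sum_add_distrib, Finset.sum_ite_eq,
    Finset.sum_ite_eq', Finset.mem_univ, if_true, Finset.sum_const, Finset.card_univ,
    nsmul_eq_mul, ← Finset.sum_mul]
  ring

/-- `Σ_a (h ⊙ δ)_{abad} = −((m−2) h_{bd} + (tr h) δ_{bd})` (`m = |ι|`). [cite: Besse1987, 1.116] -/
theorem sum_kulkarniNomizu_frameDelta_contract₁₃ (h : ι → ι → ℝ) (b d : ι) :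
    ∑ a, kulkarniNomizu h frameDelta a b a d =
      -(((Fintype.card ι : ℝ) - 2) * h b d + (∑ a, h a a) * frameDelta b d) := by
  have h1 : ∀ a, kulkarniNomizu h frameDelta a b a d =
      (if b = a then h a d else 0) + (if a = d then h b a else 0) - h a a * frameDelta b d - h b d := by
    intro a
    simp only [kulkarniNomizu, frameDelta, mul_ite, mul_one, mul_zero, if_true]
  simp only [h1, Finset.sum_sub_distrib, Finset.sum_add_distrib, Finset.sum_ite_eq,
    Finset.sum_ite_eq', Finset.mem_univ, if_true, Finset.sum_const, Finset.card_univ,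
    nsmul_eq_mul, ← Finset.sum_mul]
  ring

/-- `Σ_a δ_{ba} h_{ba} = h_{bb}`-type collapse: `Σ_a Σ_b X_{ab} δ_{ab} = Σ_a X_{aa}`. [folklore] -/
theorem sum_sum_mul_frameDelta (X : ι → ι → ℝ) : ∑ a, ∑ b, X a b * frameDelta a b = ∑ a, X a a :=
  Finset.sum_congr rfl fun a _ ↦ sum_mul_frameDelta_left (X a) a

/-- **`|h ⊙ δ|² = 4(m−2)|h|² + 4(tr h)²`** in dimension `m = |ι|` (the general case of
`sum_kulkarniNomizu_frameDelta_sq`, `ChangGurskyYangProofs.lean`; Besse 1987, 1.116: the norm of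
the `g ⊙ S²`-component). [cite: Besse1987, 1.116] -/
theorem sum_kulkarniNomizu_frameDelta_sq_card (h : ι → ι → ℝ) :
    ∑ i, ∑ j, ∑ k, ∑ l, kulkarniNomizu h frameDelta i j k l ^ 2 =
      4 * ((Fintype.card ι : ℝ) - 2) * ∑ a, ∑ b, h a b ^ 2 + 4 * (∑ a, h a a) ^ 2 := by
  have hsq : ∀ i j k l, kulkarniNomizu h frameDelta i j k l ^ 2 =
      kulkarniNomizu h frameDelta i j k l * kulkarniNomizu h frameDelta i j k l := fun _ _ _ _ ↦ sq _
  simp only [hsq]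
  rw [sum_mul_kulkarniNomizu_frameDelta_card]
  simp only [sum_kulkarniNomizu_frameDelta_contract₂₃, sum_kulkarniNomizu_frameDelta_contract₁₄,
    sum_kulkarniNomizu_frameDelta_contract₂₄, sum_kulkarniNomizu_frameDelta_contract₁₃]
  have hX : ∀ a b, (((Fintype.card ι : ℝ) - 2) * h a b + (∑ c, h c c) * frameDelta a b) * h a b =
      ((Fintype.card ι : ℝ) - 2) * h a b ^ 2 + (∑ c, h c c) * (h a b * frameDelta a b) := by
    intro a b; ring
  simp only [neg_mul, hX, Finset.sum_add_distrib, Finset.sum_neg_distrib, ← Finset.mul_sum,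
    sum_sum_mul_frameDelta]
  ring

/-- `Σ_{ij} (h ⊙ δ)_{ijji} = (2m−2) tr h`. [cite: Besse1987, 1.116] -/
theorem sum_sum_kulkarniNomizu_frameDelta_diag (h : ι → ι → ℝ) :
    ∑ i, ∑ j, kulkarniNomizu h frameDelta i j j i = (2 * (Fintype.card ι : ℝ) - 2) * ∑ a, h a a := by
  simp only [sum_kulkarniNomizu_frameDelta_contract₂₃, frameDelta_self, mul_one,
    Finset.sum_add_distrib, Finset.sum_const, Finset.card_univ, nsmul_eq_mul, ← Finset.mul_sum]
  ring

/-- `Σ_{ij} (h ⊙ δ)_{ijij} = −(2m−2) tr h`. [cite: Besse1987, 1.116] -/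
theorem sum_sum_kulkarniNomizu_frameDelta_antidiag (h : ι → ι → ℝ) :
    ∑ i, ∑ j, kulkarniNomizu h frameDelta i j i j = -((2 * (Fintype.card ι : ℝ) - 2) * ∑ a, h a a) := by
  simp only [sum_kulkarniNomizu_frameDelta_contract₂₄, frameDelta_self, mul_one,
    Finset.sum_neg_distrib, Finset.sum_add_distrib, Finset.sum_const, Finset.card_univ,
    nsmul_eq_mul, ← Finset.mul_sum]
  ring

/-- **`⟨h ⊙ δ, D⟩ = (4m−4) tr h`** for `D = δ_{il}δ_{jk} − δ_{ik}δ_{jl}`. [cite: Besse1987, 1.116] -/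
theorem sum_kulkarniNomizu_frameDelta_mul_frameDeltaPair_card (h : ι → ι → ℝ) :
    ∑ i, ∑ j, ∑ k, ∑ l, kulkarniNomizu h frameDelta i j k l *
        ((if i = l then 1 else 0) * (if j = k then 1 else 0) -
          (if i = k then 1 else 0) * (if j = l then 1 else 0)) =
      (4 * (Fintype.card ι : ℝ) - 4) * ∑ a, h a a := by
  rw [sum_mul_frameDeltaPair_card, sum_sum_kulkarniNomizu_frameDelta_diag,
    sum_sum_kulkarniNomizu_frameDelta_antidiag]
  ring

/-- **`|D|² = 2m(m−1)`** for `D = δ_{il}δ_{jk} − δ_{ik}δ_{jl}` (`m = |ι|`). [folklore] -/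
theorem sum_frameDeltaPair_sq_card :
    ∑ i : ι, ∑ j : ι, ∑ k : ι, ∑ l : ι,
        ((if i = l then (1 : ℝ) else 0) * (if j = k then 1 else 0) -
          (if i = k then 1 else 0) * (if j = l then 1 else 0)) ^ 2 =
      2 * (Fintype.card ι : ℝ) * ((Fintype.card ι : ℝ) - 1) := by
  have hsq : ∀ i j k l : ι, ((if i = l then (1 : ℝ) else 0) * (if j = k then 1 else 0) -
      (if i = k then 1 else 0) * (if j = l then 1 else 0)) ^ 2 =
      ((if i = l then (1 : ℝ) else 0) * (if j = k then 1 else 0) -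
          (if i = k then 1 else 0) * (if j = l then 1 else 0)) *
        ((if i = l then (1 : ℝ) else 0) * (if j = k then 1 else 0) -
          (if i = k then 1 else 0) * (if j = l then 1 else 0)) := fun _ _ _ _ ↦ sq _
  simp only [hsq]
  rw [sum_mul_frameDeltaPair_card]
  have hprod : ∀ i j : ι, ((if i = j then (1 : ℝ) else 0) * if j = i then 1 else 0) =
      if i = j then 1 else 0 := by
    intro i j
    by_cases hij : i = j
    · subst hij; simp
    · simp [hij]
  simp only [if_true, mul_one, hprod, Finset.sum_sub_distrib, Finset.sum_const, Finset.card_univ,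
    nsmul_eq_mul, Finset.sum_ite_eq, Finset.mem_univ]
  ring

end FrameAlgebra

/-! ### Contractions of the curvature array of a `C²` metric in a frame computing `Ric` and `S` -/

section Curvature

open Literature.Geometry.Lorentzian (PseudoRiemannianMetric)
open Literature.Geometry.Lorentzian.PseudoRiemannianMetric

variable {E : Type*} [NormedAddCommGroup E] [NormedSpace ℝ E] {H : Type*} [TopologicalSpace H]
  {I : ModelWithCorners ℝ E H} {M : Type*} [TopologicalSpace M] [ChartedSpace H M]
  [IsManifold I ∞ M] {n : ℕ∞ω}
  (g : PseudoRiemannianMetric I n E (TangentSpace I : M → Type _))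
  [FiniteDimensional ℝ E] [g.HasLeviCivita] [Fact (1 ≤ n)] [CompleteSpace E]

/-- `Σ_j Rm_{ijjl} = Ric_{il}` in a frame computing the Ricci contraction (`Rm_{ijjl} = Rm_{jilj}`
by the two antisymmetries). [cite: ONeill1983, Ch. 3, Prop. 3.36] -/
theorem _root_.Literature.Geometry.Lorentzian.PseudoRiemannianMetric.sum_curvatureForm_contract₂₃
    (hn : 2 ≤ n) (x : M) {ι : Type*} [Fintype ι] (e : ι → TangentSpace I x)
    (hRic : ∀ a b, ∑ i, g.curvatureForm g.leviCivita x (e i) (e a) (e b) (e i) = g.ricci x (e a) (e b))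
    (i l : ι) :
    ∑ j, g.curvatureForm g.leviCivita x (e i) (e j) (e j) (e l) = g.ricci x (e i) (e l) := by
  rw [← hRic i l]
  refine Finset.sum_congr rfl fun j _ ↦ ?_
  rw [g.curvatureForm_antisymm g.leviCivita x (e i) (e j),
    g.curvatureForm_leviCivita_antisymm₃₄ hn x (e j) (e i) (e j) (e l), neg_neg]

omit [FiniteDimensional ℝ E] [Fact (1 ≤ n)] [CompleteSpace E] in
/-- `Σ_j Rm_{ijkj} = −Ric_{ik}` in a frame computing the Ricci contraction.
[cite: ONeill1983, Ch. 3, Prop. 3.36] -/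
theorem _root_.Literature.Geometry.Lorentzian.PseudoRiemannianMetric.sum_curvatureForm_contract₂₄
    (x : M) {ι : Type*} [Fintype ι] (e : ι → TangentSpace I x)
    (hRic : ∀ a b, ∑ i, g.curvatureForm g.leviCivita x (e i) (e a) (e b) (e i) = g.ricci x (e a) (e b))
    (i k : ι) :
    ∑ j, g.curvatureForm g.leviCivita x (e i) (e j) (e k) (e j) = - g.ricci x (e i) (e k) := by
  rw [← hRic i k, ← Finset.sum_neg_distrib]
  refine Finset.sum_congr rfl fun j _ ↦ ?_
  rw [g.curvatureForm_antisymm g.leviCivita x (e i) (e j)]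

/-- `Σ_i Rm_{ijil} = −Ric_{jl}` in a frame computing the Ricci contraction.
[cite: ONeill1983, Ch. 3, Prop. 3.36] -/
theorem _root_.Literature.Geometry.Lorentzian.PseudoRiemannianMetric.sum_curvatureForm_contract₁₃
    (hn : 2 ≤ n) (x : M) {ι : Type*} [Fintype ι] (e : ι → TangentSpace I x)
    (hRic : ∀ a b, ∑ i, g.curvatureForm g.leviCivita x (e i) (e a) (e b) (e i) = g.ricci x (e a) (e b))
    (j l : ι) :
    ∑ i, g.curvatureForm g.leviCivita x (e i) (e j) (e i) (e l) = - g.ricci x (e j) (e l) := by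
  rw [← hRic j l, ← Finset.sum_neg_distrib]
  refine Finset.sum_congr rfl fun i _ ↦ ?_
  rw [g.curvatureForm_leviCivita_antisymm₃₄ hn x (e i) (e j) (e i) (e l)]

omit [Fact (1 ≤ n)] [CompleteSpace E] in
/-- `Σ_{ij} Rm_{ijji} = S` in a frame computing `Ric` and `S`. [cite: ONeill1983, Ch. 3, Def. 3.53] -/
theorem _root_.Literature.Geometry.Lorentzian.PseudoRiemannianMetric.sum_sum_curvatureForm_diag
    (x : M) {ι : Type*} [Fintype ι] (e : ι → TangentSpace I x)
    (hRic : ∀ a b, ∑ i, g.curvatureForm g.leviCivita x (e i) (e a) (e b) (e i) = g.ricci x (e a) (e b))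
    (hS : ∑ i, g.ricci x (e i) (e i) = g.scalarCurvature x) :
    ∑ i, ∑ j, g.curvatureForm g.leviCivita x (e i) (e j) (e j) (e i) = g.scalarCurvature x := by
  rw [Finset.sum_comm, ← hS]
  exact Finset.sum_congr rfl fun j _ ↦ hRic j j

/-- `Σ_{ij} Rm_{ijij} = −S` in a frame computing `Ric` and `S`. [cite: ONeill1983, Ch. 3, Def. 3.53] -/
theorem _root_.Literature.Geometry.Lorentzian.PseudoRiemannianMetric.sum_sum_curvatureForm_antidiag
    (hn : 2 ≤ n) (x : M) {ι : Type*} [Fintype ι] (e : ι → TangentSpace I x)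
    (hRic : ∀ a b, ∑ i, g.curvatureForm g.leviCivita x (e i) (e a) (e b) (e i) = g.ricci x (e a) (e b))
    (hS : ∑ i, g.ricci x (e i) (e i) = g.scalarCurvature x) :
    ∑ i, ∑ j, g.curvatureForm g.leviCivita x (e i) (e j) (e i) (e j) = - g.scalarCurvature x := by
  rw [← g.sum_sum_curvatureForm_diag x e hRic hS, ← Finset.sum_neg_distrib]
  refine Finset.sum_congr rfl fun i _ ↦ ?_
  rw [← Finset.sum_neg_distrib]
  refine Finset.sum_congr rfl fun j _ ↦ ?_
  rw [g.curvatureForm_leviCivita_antisymm₃₄ hn x (e i) (e j) (e i) (e j)]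

/-- **`⟨Rm, Ric ⊙ δ⟩ = 4|Ric|²`** in a frame computing the Ricci contraction, for a `C²` metric.
[cite: Besse1987, Thm. 1.114] -/
theorem _root_.Literature.Geometry.Lorentzian.PseudoRiemannianMetric.sum_curvatureForm_mul_kulkarniNomizu_ricci
    (hn : 2 ≤ n) (x : M) {ι : Type*} [Fintype ι] [DecidableEq ι] (e : ι → TangentSpace I x)
    (hRic : ∀ a b, ∑ i, g.curvatureForm g.leviCivita x (e i) (e a) (e b) (e i) = g.ricci x (e a) (e b)) :
    ∑ i, ∑ j, ∑ k, ∑ l, g.curvatureForm g.leviCivita x (e i) (e j) (e k) (e l) *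
        kulkarniNomizu (fun a b ↦ g.ricci x (e a) (e b)) frameDelta i j k l =
      4 * g.ricciNormSqFrame x e := by
  rw [sum_mul_kulkarniNomizu_frameDelta_card]
  simp only [g.sum_curvatureForm_contract₂₃ hn x e hRic, hRic,
    g.sum_curvatureForm_contract₂₄ x e hRic, g.sum_curvatureForm_contract₁₃ hn x e hRic,
    ricciNormSqFrame, neg_mul, Finset.sum_neg_distrib, sub_neg_eq_add, sq]
  ring

/-- **`⟨Rm, D⟩ = 2S`** (`D = δ_{il}δ_{jk} − δ_{ik}δ_{jl}`) in a frame computing `Ric` and `S`, for a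
`C²` metric. [cite: Besse1987, Thm. 1.114] -/
theorem _root_.Literature.Geometry.Lorentzian.PseudoRiemannianMetric.sum_curvatureForm_mul_frameDeltaPair
    (hn : 2 ≤ n) (x : M) {ι : Type*} [Fintype ι] [DecidableEq ι] (e : ι → TangentSpace I x)
    (hRic : ∀ a b, ∑ i, g.curvatureForm g.leviCivita x (e i) (e a) (e b) (e i) = g.ricci x (e a) (e b))
    (hS : ∑ i, g.ricci x (e i) (e i) = g.scalarCurvature x) :
    ∑ i, ∑ j, ∑ k, ∑ l, g.curvatureForm g.leviCivita x (e i) (e j) (e k) (e l) *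
        ((if i = l then 1 else 0) * (if j = k then 1 else 0) -
          (if i = k then 1 else 0) * (if j = l then 1 else 0)) =
      2 * g.scalarCurvature x := by
  rw [sum_mul_frameDeltaPair_card, g.sum_sum_curvatureForm_diag x e hRic hS,
    g.sum_sum_curvatureForm_antidiag hn x e hRic hS]
  ring

/-! ### The identity `|W|² = |Rm|² − (4/(m−2))|Ric|² + (2/((m−1)(m−2))) S²` -/

/-- **`|W|² = |Rm|² − (4/(m−2))|Ric|² + (2/((m−1)(m−2))) S²` in every dimension `m ≥ 3`**
(Besse 1987, 1.116–1.117: the Pythagorean form of the decomposition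
`R = W + (1/(m−2)) z ⊙ g + (s/(2m(m−1))) g ⊙ g`), in a frame of cardinality `m` computing the
Ricci contraction and the scalar curvature, for a `C²` metric: expand
`W = Rm − (1/(m−2)) Ric ⊙ δ + (S/((m−1)(m−2))) D`, `D = δ_{il}δ_{jk} − δ_{ik}δ_{jl}`, and use
`|Ric ⊙ δ|² = 4(m−2)|Ric|² + 4S²`, `|D|² = 2m(m−1)`, `⟨Rm, Ric ⊙ δ⟩ = 4|Ric|²`, `⟨Rm, D⟩ = 2S`,
`⟨Ric ⊙ δ, D⟩ = (4m−4)S`. The `Fin 4` case is `weylNormSqFrame_eq_curvNormSqFrame_of_frame`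
(`ChangGurskyYangProofs.lean`). [cite: Besse1987, (1.116)–1.117] -/
theorem _root_.Literature.Geometry.Lorentzian.PseudoRiemannianMetric.weylNormSqFrame_eq_curvNormSqFrame_card
    (hn : 2 ≤ n) (x : M) {ι : Type*} [Fintype ι] [DecidableEq ι] (hι : 3 ≤ Fintype.card ι)
    (e : ι → TangentSpace I x)
    (hRic : ∀ a b, ∑ i, g.curvatureForm g.leviCivita x (e i) (e a) (e b) (e i) = g.ricci x (e a) (e b))
    (hS : ∑ i, g.ricci x (e i) (e i) = g.scalarCurvature x) :
    g.weylNormSqFrame x e =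
      g.curvNormSqFrame x e - 4 / ((Fintype.card ι : ℝ) - 2) * g.ricciNormSqFrame x e +
        2 / (((Fintype.card ι : ℝ) - 1) * ((Fintype.card ι : ℝ) - 2)) * g.scalarCurvature x ^ 2 := by
  have h3 : (3 : ℝ) ≤ Fintype.card ι := by exact_mod_cast hι
  have hm2 : (Fintype.card ι : ℝ) - 2 ≠ 0 := by linarith
  have hm1 : (Fintype.card ι : ℝ) - 1 ≠ 0 := by linarith
  set R : ι → ι → ι → ι → ℝ := fun i j k l ↦ g.curvatureForm g.leviCivita x (e i) (e j) (e k) (e l)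
    with hR
  set A : ι → ι → ι → ι → ℝ := kulkarniNomizu (fun a b ↦ g.ricci x (e a) (e b)) frameDelta with hA
  set D : ι → ι → ι → ι → ℝ := fun i j k l ↦
    ((if i = l then (1 : ℝ) else 0) * (if j = k then 1 else 0) -
      (if i = k then 1 else 0) * (if j = l then 1 else 0)) with hD
  set c₁ : ℝ := 1 / ((Fintype.card ι : ℝ) - 2) with hc₁
  set c₂ : ℝ := g.scalarCurvature x / (((Fintype.card ι : ℝ) - 1) * ((Fintype.card ι : ℝ) - 2))
    with hc₂
  -- `W = R − c₁ A + c₂ D`, component-wise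
  have hW : ∀ i j k l, g.weylFrame x e i j k l = R i j k l - c₁ * A i j k l + c₂ * D i j k l := by
    intro i j k l
    rw [weylFrame_apply]
    simp only [hR, hA, hD, hc₁, hc₂, kulkarniNomizu, frameDelta]
  -- the squared components
  have hsq : ∀ i j k l, g.weylFrame x e i j k l ^ 2 =
      R i j k l ^ 2 + c₁ ^ 2 * A i j k l ^ 2 + c₂ ^ 2 * D i j k l ^ 2 -
        2 * c₁ * (R i j k l * A i j k l) + 2 * c₂ * (R i j k l * D i j k l) -
        2 * c₁ * c₂ * (A i j k l * D i j k l) := by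
    intro i j k l
    rw [hW]
    ring
  -- the six sums
  have hRR : ∑ i, ∑ j, ∑ k, ∑ l, R i j k l ^ 2 = g.curvNormSqFrame x e := rfl
  have hAA : ∑ i, ∑ j, ∑ k, ∑ l, A i j k l ^ 2 =
      4 * ((Fintype.card ι : ℝ) - 2) * g.ricciNormSqFrame x e + 4 * g.scalarCurvature x ^ 2 := by
    simp only [hA, sum_kulkarniNomizu_frameDelta_sq_card, hS]
    rfl
  have hDD : ∑ i, ∑ j, ∑ k, ∑ l, D i j k l ^ 2 =
      2 * (Fintype.card ι : ℝ) * ((Fintype.card ι : ℝ) - 1) := sum_frameDeltaPair_sq_card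
  have hRA : ∑ i, ∑ j, ∑ k, ∑ l, R i j k l * A i j k l = 4 * g.ricciNormSqFrame x e :=
    g.sum_curvatureForm_mul_kulkarniNomizu_ricci hn x e hRic
  have hRD : ∑ i, ∑ j, ∑ k, ∑ l, R i j k l * D i j k l = 2 * g.scalarCurvature x :=
    g.sum_curvatureForm_mul_frameDeltaPair hn x e hRic hS
  have hAD : ∑ i, ∑ j, ∑ k, ∑ l, A i j k l * D i j k l =
      (4 * (Fintype.card ι : ℝ) - 4) * g.scalarCurvature x := by
    simp only [hA, hD, sum_kulkarniNomizu_frameDelta_mul_frameDeltaPair_card, hS]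
  simp only [weylNormSqFrame, hsq, Finset.sum_add_distrib, Finset.sum_sub_distrib, ← Finset.mul_sum,
    hRR, hAA, hDD, hRA, hRD, hAD]
  rw [hc₁, hc₂]
  field_simp
  ring

/-- **`|W|² = |Rm|² − (4/(m−2))|Ric|² + (2/((m−1)(m−2))) S²` in every orthonormal basis** of a
`C²` metric on a model of dimension `m ≥ 3` (frame indexed by any `ι` with `|ι| = m`).
[cite: Besse1987, (1.116)–1.117] -/
theorem _root_.Literature.Geometry.Lorentzian.PseudoRiemannianMetric.weylNormSqFrame_eq_curvNormSqFrame_of_isOrthonormalFrame_card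
    (hn : 2 ≤ n) (h3 : 3 ≤ finrank ℝ E) {x : M} {ι : Type*} [Fintype ι] [DecidableEq ι]
    {e : ι → TangentSpace I x} (he : g.IsOrthonormalFrame x e) (hι : Fintype.card ι = finrank ℝ E) :
    g.weylNormSqFrame x e =
      g.curvNormSqFrame x e - 4 / ((finrank ℝ E : ℝ) - 2) * g.ricciNormSqFrame x e +
        2 / (((finrank ℝ E : ℝ) - 1) * ((finrank ℝ E : ℝ) - 2)) * g.scalarCurvature x ^ 2 := by
  have hRic : ∀ a b, ∑ i, g.curvatureForm g.leviCivita x (e i) (e a) (e b) (e i) =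
      g.ricci x (e a) (e b) := fun a b ↦ by
    have h := g.ricci_eq_sum_of_isOrthonormalFrame (he.toBasis hι)
      (by rw [he.coe_toBasis hι]; exact he) g.leviCivita (e a) (e b)
    rw [he.coe_toBasis hι] at h
    exact h.symm
  have hS : ∑ i, g.ricci x (e i) (e i) = g.scalarCurvature x := by
    have h := g.trace_eq_sum_of_isOrthonormalFrame (he.toBasis hι)
      (by rw [he.coe_toBasis hι]; exact he) (g.ricci x)
    rw [he.coe_toBasis hι] at h
    exact h.symm
  rw [g.weylNormSqFrame_eq_curvNormSqFrame_card hn x (by rw [hι]; exact h3) e hRic hS, hι]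

end Curvature

/-! ### `|W_g|²` through intrinsic quantities, and its continuity, in dimension `≥ 3` -/

section Regularity

open Literature.Geometry.Lorentzian (PseudoRiemannianMetric)
open Literature.Geometry.Lorentzian.PseudoRiemannianMetric
open Literature.Geometry.Lorentzian

variable {E : Type*} [NormedAddCommGroup E] [NormedSpace ℝ E] {H : Type*} [TopologicalSpace H]
  {I : ModelWithCorners ℝ E H} {M : Type*} [TopologicalSpace M] [ChartedSpace H M]
  [IsManifold I ∞ M]
  (g : PseudoRiemannianMetric I ∞ E (TangentSpace I : M → Type _))
  [FiniteDimensional ℝ E] [g.HasLeviCivita] [CompleteSpace E] [I.Boundaryless]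

/-- **`|W_g|²(x) = |Rm|²_g − (4/(m−2))|Ric|²_g + (2/((m−1)(m−2))) S²`** through the intrinsic
quantities `curvNormSqWith` (`|Rm|²`, `CurvatureNormSq.lean`), `normSq Ric` (`MetricNormSq.lean`)
and `scalarCurvature`, for a Riemannian `C^∞` metric on a model of dimension `m = dim E ≥ 3`
(the dimension-four case is `weylNormSq_eq_curvNormSqWith`). [cite: Besse1987, (1.116)–1.117] -/
theorem _root_.Literature.Geometry.Lorentzian.PseudoRiemannianMetric.weylNormSq_eq_curvNormSqWith_card
    (hg : g.IsRiemannian) (h3 : 3 ≤ finrank ℝ E) (x : M) :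
    g.weylNormSq x = g.curvNormSqWith g.leviCivita x -
      4 / ((finrank ℝ E : ℝ) - 2) * g.normSq x (g.ricci x) +
        2 / (((finrank ℝ E : ℝ) - 1) * ((finrank ℝ E : ℝ) - 2)) * g.scalarCurvature x ^ 2 := by
  classical
  obtain ⟨b, hb⟩ := g.exists_basis_isOrthonormalFrame (x := x) (fun v hv ↦ hg x v hv) rfl
  have hcard : Fintype.card (Fin (finrank ℝ E)) = finrank ℝ E := Fintype.card_fin _
  rw [g.weylNormSq_eq_weylNormSqFrame hb,
    g.weylNormSqFrame_eq_curvNormSqFrame_of_isOrthonormalFrame_card (WithTop.coe_le_coe.mpr le_top)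
      h3 hb hcard,
    g.curvNormSqFrame_eq_curvNormSqWith hg hb hcard, g.ricciNormSqFrame_eq_normSq hb hcard]

/-- **`|W_g|²` is continuous in every dimension `≥ 3`** (`|Rm|² − (4/(m−2))|Ric|² +
(2/((m−1)(m−2))) S²`, each term continuous: `continuous_curvNormSqWith`, `contMDiff_normSq_ricci'`,
`contMDiff_scalarCurvature`), for a Riemannian `C^∞` metric — the regularity behind "there exists
a point `p_j` so that `|W|(p_j) = max |W|`" in Step 1 of the proof of Li–Qing–Shi's Thm. 1.8.
[cite: Besse1987, (1.116)–1.117] [cite: LiQingShi2017, Thm. 1.8 (proof, Step 1, pp. 12–13)] -/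
theorem _root_.Literature.Geometry.Lorentzian.PseudoRiemannianMetric.continuous_weylNormSq_card
    (hg : g.IsRiemannian) (h3 : 3 ≤ finrank ℝ E) : Continuous g.weylNormSq := by
  have h : g.weylNormSq = fun x ↦ g.curvNormSqWith g.leviCivita x -
      4 / ((finrank ℝ E : ℝ) - 2) * g.normSq x (g.ricci x) +
        2 / (((finrank ℝ E : ℝ) - 1) * ((finrank ℝ E : ℝ) - 2)) * g.scalarCurvature x ^ 2 :=
    funext fun x ↦ g.weylNormSq_eq_curvNormSqWith_card hg h3 x
  rw [h]
  exact ((g.continuous_curvNormSqWith).sub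
    (continuous_const.mul (g.contMDiff_normSq_ricci').continuous)).add
    (continuous_const.mul (g.contMDiff_scalarCurvature.continuous.pow 2))

omit [FiniteDimensional ℝ E] [CompleteSpace E] [I.Boundaryless] g in
/-- **`|W_g|²` is continuous on a `5`-manifold modelled on `ℝ⁵`** — the bulk of
`liQingShi_pinching_five` — for every smooth Riemannian metric `g` (`ofRiemannian g`, with its
Levi-Civita connection). [cite: LiQingShi2017, Thm. 1.8 (proof, Step 1, pp. 12–13)] -/
theorem continuous_weylNormSq_five {N : Type*} [TopologicalSpace N]
    [ChartedSpace (EuclideanSpace ℝ (Fin 5)) N] [IsManifold (𝓡 5) ∞ N]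
    (g : Bundle.ContMDiffRiemannianMetric (𝓡 5) ∞ (EuclideanSpace ℝ (Fin 5))
      (TangentSpace (𝓡 5) : N → Type _))
    [(PseudoRiemannianMetric.ofRiemannian g).HasLeviCivita] :
    Continuous (PseudoRiemannianMetric.ofRiemannian g).weylNormSq :=
  (ofRiemannian g).continuous_weylNormSq_card (isRiemannian_ofRiemannian g)
    (by rw [finrank_euclideanSpace_fin]; norm_num)

end Regularity

end Literature.Geometry.Riemannian
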